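import Mathlib

/-!
# The abstract sector-gap moment inequality

Solo line II ("Landau ⟹ BEC"), algebraic core of the two-sided Feynman–Wagner / Pitaevskii–Stringari
sum-rule bound *read backwards* (paper §10.2, Proposition 10.1).

Let `H` be a symmetric linear operator on a complex inner-product space, `Ψ` an eigenvector
`H Ψ = e Ψ` (`e` real), and `A`, `B` linear maps that are formal adjoints of each other
(`⟪A x, y⟫ = ⟪x, B y⟫`; think `A = a_k`, `B = a_k†`). Then

* `inner_doubleCommutator_eq` : `⟪Ψ, [A,[H,B]] Ψ⟫ = ⟪BΨ,(H-e)BΨ⟫ + ⟪AΨ,(H-e)AΨ⟫`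
  (the double commutator written out as `A H B - A B H - H B A + B H A`);
* `sectorGap_moment_le` : if `BΨ` lies in a set `S₁` on which the form of `H` is `≥ e + ω₁` and `AΨ`
  in a set `S₂` on which it is `≥ e + ω₂` (momentum sectors of `N ± 1` particles in the application),
  then `ω₂ ‖AΨ‖² + ω₁ ‖BΨ‖² ≤ re ⟪Ψ, [A,[H,B]] Ψ⟫`;
* `norm_sq_le_doubleCommutator_div` : with the commutation relation `‖BΨ‖² = ‖AΨ‖² + c`, `c ≥ 0`,
  the "occupation" `‖AΨ‖²` is at most `re ⟪Ψ,[A,[H,B]]Ψ⟫ / (ω₁ + ω₂)`.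

No analysis enters; the application supplies `H = H_N` on the torus, `A = a_k`, the sector infima
`E_{N∓1}(∓k)` and the explicit double commutator `ε_k + V⁻¹(v̂(0)N + Σ_p v̂(p-k) n_p)`.
-/

namespace Summit.AtomisticToContinuum.BoseEinsteinCondensation.Theorems

open scoped InnerProductSpace ComplexConjugate

variable {E : Type*} [NormedAddCommGroup E] [InnerProductSpace ℂ E]

/-- If `⟪A x, y⟫ = ⟪x, B y⟫` for all `x, y`, then also `⟪B x, y⟫ = ⟪x, A y⟫`. -/
theorem inner_formalAdjoint_symm {A B : E →ₗ[ℂ] E} (hAB : ∀ x y : E, ⟪A x, y⟫_ℂ = ⟪x, B y⟫_ℂ)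
    (x y : E) : ⟪B x, y⟫_ℂ = ⟪x, A y⟫_ℂ := by
  rw [← inner_conj_symm (B x) y, ← hAB y x]
  exact inner_conj_symm x (A y)

/-- **Double-commutator identity.** For a symmetric `H` with eigenvector `H Ψ = e Ψ` and formal
adjoints `A`, `B`:
`⟪Ψ, (A H B - A B H - H B A + B H A) Ψ⟫ = (⟪BΨ, H BΨ⟫ - e‖BΨ‖²) + (⟪AΨ, H AΨ⟫ - e‖AΨ‖²)`. -/
theorem inner_doubleCommutator_eq (H A B : E →ₗ[ℂ] E) (hH : H.IsSymmetric)
    (hAB : ∀ x y : E, ⟪A x, y⟫_ℂ = ⟪x, B y⟫_ℂ) {Ψ : E} {e : ℝ} (hΨ : H Ψ = (e : ℂ) • Ψ) :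
    ⟪Ψ, A (H (B Ψ)) - A (B (H Ψ)) - H (B (A Ψ)) + B (H (A Ψ))⟫_ℂ
      = (⟪B Ψ, H (B Ψ)⟫_ℂ - (e : ℂ) * (‖B Ψ‖ : ℂ) ^ 2)
        + (⟪A Ψ, H (A Ψ)⟫_ℂ - (e : ℂ) * (‖A Ψ‖ : ℂ) ^ 2) := by
  have hBA := inner_formalAdjoint_symm hAB
  have t1 : ⟪Ψ, A (H (B Ψ))⟫_ℂ = ⟪B Ψ, H (B Ψ)⟫_ℂ := by rw [← hBA]
  have t2 : ⟪Ψ, A (B (H Ψ))⟫_ℂ = (e : ℂ) * (‖B Ψ‖ : ℂ) ^ 2 := by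
    rw [← hBA, hΨ, map_smul, inner_smul_right, inner_self_eq_norm_sq_to_K]
    exact rfl
  have t3 : ⟪Ψ, H (B (A Ψ))⟫_ℂ = (e : ℂ) * (‖A Ψ‖ : ℂ) ^ 2 := by
    rw [← hH, hΨ, inner_smul_left, ← hAB, inner_self_eq_norm_sq_to_K, Complex.conj_ofReal]
    exact rfl
  have t4 : ⟪Ψ, B (H (A Ψ))⟫_ℂ = ⟪A Ψ, H (A Ψ)⟫_ℂ := by rw [← hAB]
  rw [inner_add_right, inner_sub_right, inner_sub_right, t1, t2, t3, t4]
  ring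

/-- **Abstract sector-gap moment inequality** (Proposition 10.1 of the solo paper, abstract form).
If the quadratic form of `H` is at least `e + ω₁` on a set containing `BΨ` and at least `e + ω₂` on
a set containing `AΨ`, then `ω₂‖AΨ‖² + ω₁‖BΨ‖² ≤ re ⟪Ψ, [A,[H,B]] Ψ⟫`. -/
theorem sectorGap_moment_le (H A B : E →ₗ[ℂ] E) (hH : H.IsSymmetric)
    (hAB : ∀ x y : E, ⟪A x, y⟫_ℂ = ⟪x, B y⟫_ℂ) {Ψ : E} {e : ℝ} (hΨ : H Ψ = (e : ℂ) • Ψ)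
    {S₁ S₂ : Set E} (hB : B Ψ ∈ S₁) (hA : A Ψ ∈ S₂) {ω₁ ω₂ : ℝ}
    (hgap₁ : ∀ x ∈ S₁, (e + ω₁) * ‖x‖ ^ 2 ≤ (⟪x, H x⟫_ℂ).re)
    (hgap₂ : ∀ x ∈ S₂, (e + ω₂) * ‖x‖ ^ 2 ≤ (⟪x, H x⟫_ℂ).re) :
    ω₂ * ‖A Ψ‖ ^ 2 + ω₁ * ‖B Ψ‖ ^ 2 ≤
      (⟪Ψ, A (H (B Ψ)) - A (B (H Ψ)) - H (B (A Ψ)) + B (H (A Ψ))⟫_ℂ).re := by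
  rw [inner_doubleCommutator_eq H A B hH hAB hΨ]
  have r1 : ((e : ℂ) * (‖B Ψ‖ : ℂ) ^ 2).re = e * ‖B Ψ‖ ^ 2 := by
    rw [← Complex.ofReal_pow, ← Complex.ofReal_mul, Complex.ofReal_re]
  have r2 : ((e : ℂ) * (‖A Ψ‖ : ℂ) ^ 2).re = e * ‖A Ψ‖ ^ 2 := by
    rw [← Complex.ofReal_pow, ← Complex.ofReal_mul, Complex.ofReal_re]
  simp only [Complex.add_re, Complex.sub_re, r1, r2]
  have h1 := hgap₁ _ hB
  have h2 := hgap₂ _ hA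
  linarith

/-- **Occupation bound.** Under the hypotheses of `sectorGap_moment_le`, if moreover
`‖BΨ‖² = ‖AΨ‖² + c` with `c ≥ 0` (the canonical commutation relation `[a, a†] = 1` gives
`c = ‖Ψ‖²`), `ω₁ ≥ 0` and `ω₁ + ω₂ > 0`, then
`‖AΨ‖² ≤ re ⟪Ψ, [A,[H,B]] Ψ⟫ / (ω₁ + ω₂)`: the occupation `n_k = ‖a_kΨ‖²` is bounded by the double
commutator over the two-sided sector gap. -/
theorem norm_sq_le_doubleCommutator_div (H A B : E →ₗ[ℂ] E) (hH : H.IsSymmetric)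
    (hAB : ∀ x y : E, ⟪A x, y⟫_ℂ = ⟪x, B y⟫_ℂ) {Ψ : E} {e : ℝ} (hΨ : H Ψ = (e : ℂ) • Ψ)
    {S₁ S₂ : Set E} (hB : B Ψ ∈ S₁) (hA : A Ψ ∈ S₂) {ω₁ ω₂ : ℝ}
    (hgap₁ : ∀ x ∈ S₁, (e + ω₁) * ‖x‖ ^ 2 ≤ (⟪x, H x⟫_ℂ).re)
    (hgap₂ : ∀ x ∈ S₂, (e + ω₂) * ‖x‖ ^ 2 ≤ (⟪x, H x⟫_ℂ).re)
    {c : ℝ} (hc : 0 ≤ c) (hCCR : ‖B Ψ‖ ^ 2 = ‖A Ψ‖ ^ 2 + c) (hω₁ : 0 ≤ ω₁) (hω : 0 < ω₁ + ω₂) :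
    ‖A Ψ‖ ^ 2 ≤
      (⟪Ψ, A (H (B Ψ)) - A (B (H Ψ)) - H (B (A Ψ)) + B (H (A Ψ))⟫_ℂ).re / (ω₁ + ω₂) := by
  have h := sectorGap_moment_le H A B hH hAB hΨ hB hA hgap₁ hgap₂
  rw [hCCR] at h
  rw [le_div_iff₀ hω]
  nlinarith [mul_nonneg hω₁ hc]

end Summit.AtomisticToContinuum.BoseEinsteinCondensation.Theorems
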